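import Mathlib
import HarnessLib
import Literature.MathematicalPhysics.QuantumLattice.GrassmannWeightedEffectiveActionTruncationDB
import Literature.MathematicalPhysics.QuantumLattice.GrassmannEffectiveActionBoundDB
import Summits.HubbardSuperconductivity.HubbardSuperconductivity.Theorems.KLProgrammeKLRegimeEngineScaleZeroTwoLegTadpoleSupport
import Summits.HubbardSuperconductivity.HubbardSuperconductivity.Theorems.KLProgrammeKLRegimeEngineScaleZeroNorms

/-!
# K3 engine (stmt-HubbardSuperconductivity-19918 and its gen-6 successor), stub `stub_twoLeg_scale0`: the PINNED GRID SUMS of the two-leg kernel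
# of the scale-`0` output `W_N − 𝒩_{K,N}` from ONE (weighted / plain) determinant-bounded Gaussian step

Cell gate-hubbard-kl, seat p3 (g7); the analytic half of p1b g7's hand-off (ii) (STATUS 06:28:17Z): the inputs `B₀` (plain) and, for any
diagonal-vanishing pair weight `ω` dominated by a tree weight `wt`, the `ω`-weighted pinned sums of `kernel₂ (W − 𝒩_{K,N})` — the `Bₖ`/`Bᵗ` of
`…TwoLegMomentsFromGrid.twoLeg_sep_momentumSizes_of_grid` / `…TwoLegTimeMomentFromGrid` — for the grid vertex `Ṽ = V_N + 𝒩_{K,N}` and ANY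
covariance `C` on the grid legs (at `N = 4M`, `C = S_{4M}ᵀ C^K_{>e₀} S_{4M}`, this is the cell's scale-`0` step: `…ScaleZeroNorms`, `…ScaleZeroE4Assembly`):

* **`twoLeg_offDiag_wsum_le_of_wgridStep`** — for a tree weight `wt` on the grid legs, `C` replica-Gram-bounded (`κ`) with `wt`-pair-weighted
  row/column sums `≤ α_w`, the `wt`-weighted pinned profile `N_w` of `Ṽ`, `θ_w = eα_w‖Ṽ‖_{h,wt}/κ² < 1`, and a pair weight `ω ≤ c·wt` (`c ≥ 0`) with
  `ω(Y) = 0` whenever both legs sit at the same grid point: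
  `Σ_{Y : Y 0 = w} ω(Y)·‖kernel₂ (W − 𝒩_{K,N}) Y‖ ≤ c · ρ⁻² · e‖Ṽ‖_{h,wt} · θ_w/(1 − θ_w)` — ONE MORE `θ_w = O(U)` than the full step: off the
  grid diagonal the two-leg kernel is the truncated step's (`kernel_two_effAction_sub_counter_eq_of_ne`), bounded by
  `sum_wt_norm_kernel_effAction_sub_gaussConv_le_of_gramBounded`;
* **`twoLeg_plain_sum_le_of_gridStep`** — `Σ_{Y : Y 0 = w} ‖kernel₂ (W − 𝒩_{K,N}) Y‖ ≤ ρ⁻²·e‖Ṽ‖_h/(1 − θ) + (β/N)·coeffNorm₀ K` (the FULL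
  unweighted step `sum_norm_kernel_effAction_le_of_gramBounded` plus the counterterm's own pinned norm; no tadpole bookkeeping needed);
* `sum_point_string_le_sum_pinned` — the point-indexed `σ`-strings `p₁ ↦ ((p₀,σ,+),(p₁,σ,−))` of p1b's consumer hypotheses inject into the
  pinned fibre `{Y : Y 0 = ((p₀,σ),+)}`, so every pinned bound above dominates the corresponding point sum.

The three concrete pair weights (off-diagonal `(1+|Δx̃₀|+|Δx̃₁|)ᵏ`, `k = 1, 2`, and the circular grid time distance `(β/N)·circDist_N`) and their
domination by `gridLabelWt` / its square are the sequel's; the weighted covariance sizes `α_w` are the (E4)₀ lane's inputs (k3c2-p1 / k3c4-p2)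
— for `k = 2` a SECOND space–time moment of `C^K_{>e₀}` is needed (new input, flagged on the cell bus).

Everything is PROVED; no definitions; nothing about the model is asserted.  References: BGM 2006 (2.13)–(2.14), (2.77)–(2.80), (2.86)–(2.90),
§3 (3.2)–(3.8) [cite: BenfattoGiulianiMastropietro2006]; Pedra–Salmhofer 2008 Thm 2.4 [cite: PedraSalmhofer2008].
-/

noncomputable section

namespace Summit.HubbardSuperconductivity.HubbardSuperconductivity.Theorems.EngineV8

set_option linter.dupNamespace false -- summit = problem name (single-conjunct summit), D-0017

open Real Finset Literature.MathematicalPhysics.QuantumLattice Literature.Probability.LatticeModels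
open Literature.Probability.LatticeModels.BattleFederbush GrassmannAlgebra
open Summit.HubbardSuperconductivity.HubbardSuperconductivity.Theorems.KLRegimeSplit

variable {L N : ℕ} [NeZero L]

/-! ## §1 The off-diagonal / diagonal-vanishing weighted pinned sums: one weighted truncated step -/

/-- **THE WEIGHTED OFF-DIAGONAL TWO-LEG SUMS OF THE SCALE-`0` OUTPUT FROM ONE WEIGHTED TRUNCATED DETERMINANT-BOUNDED STEP.**  Grid vertex
`Ṽ = V_N + 𝒩_{K,N}`, any covariance `C` on the grid legs, `W = effAction C Ṽ`; `wt` a tree weight with `C` replica-Gram-bounded (`κ`),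
`wt`-pair-weighted row/column sums `≤ α_w`, `wt`-weighted pinned profile `N_w` of `Ṽ`, output weight `ρ`, `θ_w = eα_w‖Ṽ‖_{h,wt}/κ² < 1`;
`ω` a pair weight vanishing when both legs sit at one grid point and `≤ c·wt` (`c ≥ 0`).  Then for every pinned leg `w`:
`Σ_{Y : Y 0 = w} ω(Y)·‖kernel₂ (W − 𝒩_{K,N}) Y‖ ≤ c·(ρ⁻²·e‖Ṽ‖_{h,wt}·θ_w/(1−θ_w))`. -/
theorem twoLeg_offDiag_wsum_le_of_wgridStep (C : Matrix (GridLeg (GridPoint L N)) (GridLeg (GridPoint L N)) ℂ) (β U : ℝ) (K : TrigPolyC4v)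
    {wt : Finset (GridLeg (GridPoint L N)) → ℝ} (hwt : IsTreeWeight wt) {κ : ℝ} (hκ : 0 < κ) (hGB : IsGramBoundedR C κ)
    (Nw : ℕ → ℝ) (hNw0 : ∀ m', 0 ≤ Nw m')
    (hNw : ∀ m' (j : Fin (2 * m')) (w : GridLeg (GridPoint L N)),
      ∑ Y ∈ univ.filter (fun Y : Fin (2 * m') → GridLeg (GridPoint L N) => Y j = w),
        ‖kernel ℂ (hubbardGridInteraction L N β U + hubbardGridCounterQuadratic L N β K) (2 * m') Y‖ * wt (univ.image Y) ≤ Nw m')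
    {αw : ℝ} (hαw : 0 < αw) (hrow : ∀ X, ∑ Y, ‖C X Y‖ * wt {X, Y} ≤ αw) (hcol : ∀ Y, ∑ X, ‖C X Y‖ * wt {X, Y} ≤ αw)
    {ρ : ℝ} (hρ : 0 < ρ) (hθ : Real.exp 1 * αw * normV (GridLeg (GridPoint L N)) κ ρ Nw / κ ^ 2 < 1)
    (ω : (Fin 2 → GridLeg (GridPoint L N)) → ℝ) (hωdiag : ∀ Y, (Y 0).1.1 = (Y 1).1.1 → ω Y = 0)
    {c : ℝ} (hc : 0 ≤ c) (hωle : ∀ Y, ω Y ≤ c * wt (univ.image Y)) (w : GridLeg (GridPoint L N)) :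
    ∑ Y ∈ univ.filter (fun Y : Fin 2 → GridLeg (GridPoint L N) => Y 0 = w),
        ω Y * ‖kernel ℂ (effAction ℂ C (hubbardGridInteraction L N β U + hubbardGridCounterQuadratic L N β K) -
          hubbardGridCounterQuadratic L N β K) 2 Y‖ ≤
      c * (ρ⁻¹ ^ 2 * (Real.exp 1 * normV (GridLeg (GridPoint L N)) κ ρ Nw) *
        (Real.exp 1 * αw * normV (GridLeg (GridPoint L N)) κ ρ Nw / κ ^ 2) /
          (1 - Real.exp 1 * αw * normV (GridLeg (GridPoint L N)) κ ρ Nw / κ ^ 2)) := by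
  set Vt := hubbardGridInteraction L N β U + hubbardGridCounterQuadratic L N β K with hVt
  have hVt_even : Vt ∈ evenPart ℂ (GridLeg (GridPoint L N)) :=
    add_mem (hubbardGridInteraction_mem_evenPart β U) (hubbardGridCounterQuadratic_mem_evenPart β K)
  have hVt0 : constPart ℂ Vt = 0 := by
    rw [hVt, map_add, constPart_hubbardGridInteraction, constPart_hubbardGridCounterQuadratic, add_zero]
  -- the weighted truncated step, degree 2, leg 0 pinned
  obtain ⟨-, htr⟩ := sum_wt_norm_kernel_effAction_sub_gaussConv_le_of_gramBounded C hwt hκ hGB Vt hVt_even hVt0 Nw hNw0 hNw hαw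
    hrow hcol hρ hθ
  have h2 := htr (m := 2) two_pos 0 w
  -- termwise: off the diagonal the kernel is the truncated one; on the diagonal the weight vanishes
  have hpt : ∀ Y : Fin 2 → GridLeg (GridPoint L N),
      ω Y * ‖kernel ℂ (effAction ℂ C Vt - hubbardGridCounterQuadratic L N β K) 2 Y‖ ≤
        c * (wt (univ.image Y) * ‖kernel ℂ (effAction ℂ C Vt - gaussConv ℂ C Vt) 2 Y‖) := by
    intro Y
    by_cases hY : (Y 0).1.1 = (Y 1).1.1
    · rw [hωdiag Y hY, zero_mul]
      exact mul_nonneg hc (mul_nonneg (hwt.nonneg _) (norm_nonneg _))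
    · rw [hVt, kernel_two_effAction_sub_counter_eq_of_ne C β U K Y hY, ← mul_assoc]
      exact mul_le_mul_of_nonneg_right (hωle Y) (norm_nonneg _)
  calc ∑ Y ∈ univ.filter (fun Y : Fin 2 → GridLeg (GridPoint L N) => Y 0 = w),
        ω Y * ‖kernel ℂ (effAction ℂ C Vt - hubbardGridCounterQuadratic L N β K) 2 Y‖
      ≤ ∑ Y ∈ univ.filter (fun Y : Fin 2 → GridLeg (GridPoint L N) => Y 0 = w),
          c * (wt (univ.image Y) * ‖kernel ℂ (effAction ℂ C Vt - gaussConv ℂ C Vt) 2 Y‖) := sum_le_sum fun Y _ => hpt Y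
    _ = c * ∑ Y ∈ univ.filter (fun Y : Fin 2 → GridLeg (GridPoint L N) => Y 0 = w),
          wt (univ.image Y) * ‖kernel ℂ (effAction ℂ C Vt - gaussConv ℂ C Vt) 2 Y‖ := by rw [mul_sum]
    _ ≤ _ := mul_le_mul_of_nonneg_left h2 hc

/-! ## §2 The plain pinned sum: the full step plus the counterterm -/

/-- **THE PLAIN TWO-LEG SUM OF THE SCALE-`0` OUTPUT** (`B₀`): with the (unweighted) pinned profile `N` of `Ṽ` (`sum_norm_kernel_gridVertex_le`:
`N(1) = (|β|/N)·coeffNorm₀ K`, `N(2) = |U||β|/N`), plain row/column sums `≤ α`, `θ = eα‖Ṽ‖_h/κ² < 1`: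
`Σ_{Y : Y 0 = w} ‖kernel₂ (W − 𝒩_{K,N}) Y‖ ≤ ρ⁻²·e‖Ṽ‖_h/(1 − θ) + (|β|/N)·coeffNorm₀ K`. -/
theorem twoLeg_plain_sum_le_of_gridStep (C : Matrix (GridLeg (GridPoint L N)) (GridLeg (GridPoint L N)) ℂ) (β U : ℝ) (K : TrigPolyC4v)
    {κ : ℝ} (hκ : 0 < κ) (hGB : IsGramBoundedR C κ)
    {α : ℝ} (hα : 0 < α) (hrow : ∀ X, ∑ Y, ‖C X Y‖ ≤ α) (hcol : ∀ Y, ∑ X, ‖C X Y‖ ≤ α)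
    {ρ : ℝ} (hρ : 0 < ρ)
    (hθ : Real.exp 1 * α * normV (GridLeg (GridPoint L N)) κ ρ
      (fun m' => if m' = 1 then |β| / N * K.coeffNorm 0 else if m' = 2 then |U| * |β| / N else 0) / κ ^ 2 < 1)
    (w : GridLeg (GridPoint L N)) :
    ∑ Y ∈ univ.filter (fun Y : Fin 2 → GridLeg (GridPoint L N) => Y 0 = w),
        ‖kernel ℂ (effAction ℂ C (hubbardGridInteraction L N β U + hubbardGridCounterQuadratic L N β K) -
          hubbardGridCounterQuadratic L N β K) 2 Y‖ ≤
      ρ⁻¹ ^ 2 * (Real.exp 1 * normV (GridLeg (GridPoint L N)) κ ρ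
          (fun m' => if m' = 1 then |β| / N * K.coeffNorm 0 else if m' = 2 then |U| * |β| / N else 0)) /
        (1 - Real.exp 1 * α * normV (GridLeg (GridPoint L N)) κ ρ
          (fun m' => if m' = 1 then |β| / N * K.coeffNorm 0 else if m' = 2 then |U| * |β| / N else 0) / κ ^ 2) +
      |β| / N * K.coeffNorm 0 := by
  set Vt := hubbardGridInteraction L N β U + hubbardGridCounterQuadratic L N β K with hVt
  set Np : ℕ → ℝ := fun m' => if m' = 1 then |β| / N * K.coeffNorm 0 else if m' = 2 then |U| * |β| / N else 0 with hNp
  have hVt_even : Vt ∈ evenPart ℂ (GridLeg (GridPoint L N)) :=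
    add_mem (hubbardGridInteraction_mem_evenPart β U) (hubbardGridCounterQuadratic_mem_evenPart β K)
  have hVt0 : constPart ℂ Vt = 0 := by
    rw [hVt, map_add, constPart_hubbardGridInteraction, constPart_hubbardGridCounterQuadratic, add_zero]
  obtain ⟨-, hfull⟩ := sum_norm_kernel_effAction_le_of_gramBounded C hκ hGB Vt hVt_even hVt0 Np (scaleZeroPinned_nonneg β U K N)
    (sum_norm_kernel_gridVertex_le β U K) hα hrow hcol hρ hθ
  have hW := hfull (m := 2) two_pos 0 w
  -- the counterterm's own pinned two-leg norm (`m' = 1` of the profile)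
  have hN1 : ∑ Y ∈ univ.filter (fun Y : Fin 2 → GridLeg (GridPoint L N) => Y 0 = w),
      ‖kernel ℂ (hubbardGridCounterQuadratic L N β K) 2 Y‖ ≤ |β| / N * K.coeffNorm 0 := by
    have h := sum_norm_kernel_gridVertex_le (L := L) (Ng := N) β U K 1 0 w
    have hker : ∀ Y : Fin (2 * 1) → GridLeg (GridPoint L N),
        kernel ℂ (hubbardGridInteraction L N β U + hubbardGridCounterQuadratic L N β K) (2 * 1) Y =
          kernel ℂ (hubbardGridCounterQuadratic L N β K) 2 Y := fun Y => by
      rw [kernel_add, kernel_hubbardGridInteraction_of_ne β U (by norm_num) Y, zero_add]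
    simp only [hker, if_true] at h
    exact h
  calc ∑ Y ∈ univ.filter (fun Y : Fin 2 → GridLeg (GridPoint L N) => Y 0 = w),
        ‖kernel ℂ (effAction ℂ C Vt - hubbardGridCounterQuadratic L N β K) 2 Y‖
      ≤ ∑ Y ∈ univ.filter (fun Y : Fin 2 → GridLeg (GridPoint L N) => Y 0 = w),
          (‖kernel ℂ (effAction ℂ C Vt) 2 Y‖ + ‖kernel ℂ (hubbardGridCounterQuadratic L N β K) 2 Y‖) :=
        sum_le_sum fun Y _ => by rw [kernel_sub_apply]; exact norm_sub_le _ _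
    _ = _ := sum_add_distrib
    _ ≤ _ := add_le_add hW hN1

/-! ## §3 From point-indexed `σ`-strings to the pinned fibre -/

/-- **The point sums of the consumers are dominated by the pinned fibre sums**: for `f ≥ 0`,
`Σ_{p₁} f(((p₀,σ),+),((p₁,σ),−)) ≤ Σ_{Y : Y 0 = ((p₀,σ),+)} f(Y)` (the strings inject into the fibre). -/
theorem sum_point_string_le_sum_pinned (f : (Fin 2 → GridLeg (GridPoint L N)) → ℝ) (hf : ∀ Y, 0 ≤ f Y) (σ : Fin 2) (p₀ : GridPoint L N) :
    ∑ p₁ : GridPoint L N, f (fun i => ((![p₀, p₁] i, σ), i)) ≤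
      ∑ Y ∈ univ.filter (fun Y : Fin 2 → GridLeg (GridPoint L N) => Y 0 = ((p₀, σ), 0)), f Y := by
  classical
  set emb : GridPoint L N → (Fin 2 → GridLeg (GridPoint L N)) := fun p₁ i => ((![p₀, p₁] i, σ), i) with hemb
  have hinj : Function.Injective emb := by
    intro p q h
    have := congrFun h 1
    simp only [hemb, Matrix.cons_val_one, Matrix.cons_val_fin_one, Prod.mk.injEq] at this
    exact this.1.1
  rw [← sum_image (f := f) fun p _ q _ h => hinj h]
  refine sum_le_sum_of_subset_of_nonneg ?_ fun Y _ _ => hf Y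
  intro Y hY
  obtain ⟨p₁, -, rfl⟩ := mem_image.1 hY
  exact mem_filter.2 ⟨mem_univ _, by simp [hemb]⟩

end Summit.HubbardSuperconductivity.HubbardSuperconductivity.Theorems.EngineV8

end
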